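import Mathlib
import HarnessLib
import Literature.Analysis.FluidPDE.Tao2016AveragedNS.ViscousLatticeUniqueness

/-!
# Route `WakeRatchet`, crux `MinimalViscousBlowup` (stmt-NavierStokesRegularity-22743) — LINE g11-1 «threshold ray» (ns-idea-1 g11), input (E2, Grönwall core)
# of STUB-PLAN-regularOpen.md for stub S2 `stub_regularOpen`: CONTINUOUS DEPENDENCE ON THE VISCOSITY in a weighted sup norm

Admissible weights `w` (`WeightRatiosLE ε₀ w A`), structure constants bounded by `M_α`.  Let `X` solve the `ν`-viscous and `Y` the `ν'`-viscous
cascade lattice within `[0,s]` (`s ≤ S`) from the same state at time `0`, both with the weighted bound `w_k|·| ≤ B` on `[0,s]`, and let the viscous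
forcing of `X` be weighted-bounded, `w_k λ^{2k}|X_{i,k}| ≤ F`.  Then
`w_k |Y_{i,k}(t) − X_{i,k}(t)| ≤ 2^{⌈S(16 m² M_α A B + 1)⌉+1} · F · |ν' − ν|` on `[0,s]`
(`weighted_sub_le_of_viscosities`): the difference solves `D' = (q(Y) − q(X)) − ν'λ^{2k}D − (ν'−ν)λ^{2k}X`, the weighted nonlinearity is
`K = 8 m² M_α A B`-Lipschitz (`abs_weightedFieldFun_sub_le`), and the damping-free Duhamel bound `abs_le_of_forcing_on_Icc` is iterated over
`⌈S(2K+1)⌉` windows of length `1/(2K+1)` (geometric bootstrap inside each window, as in `viscousFlow_unique`).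
MODEL lattice ODEs only; nothing here concerns the Navier–Stokes equations.  `--supports stmt-NavierStokesRegularity-22743 --as helper`.
[cite: Tao2016AveragedNS, §4 (the viscous equation before Thm. 4.2), Lemma 4.1 (4.5); Teschl2012, §3.4 (3.97), Lemma 2.7 (Grönwall), Thm. 2.8 (dependence on parameters)]
-/

noncomputable section

-- the summit and its single sub-problem share the name (CONVENTIONS §1)
set_option linter.dupNamespace false

open Set Filter Topology BoundedContinuousFunction

namespace Summit.NavierStokesRegularity.NavierStokesRegularity.Theorems.MinimalViscousBlowup.ThresholdRay

open Literature.Analysis.FluidPDE Literature.Analysis.FluidPDE.TaoCascade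

variable {m : ℕ}

/-- If `x ≤ L + c / 2^j` for every `j`, then `x ≤ L`. [folklore] -/
theorem le_of_forall_le_add_div_two_pow {x L c : ℝ} (h : ∀ j : ℕ, x ≤ L + c / 2 ^ j) : x ≤ L := by
  by_contra hne
  have hxp : 0 < x - L := by linarith [not_le.1 hne]
  obtain ⟨j, hj⟩ := pow_unbounded_of_one_lt (c / (x - L)) (by norm_num : (1 : ℝ) < 2)
  have h1 := h j
  have h2 : c / 2 ^ j < x - L := by
    rw [div_lt_iff₀ (by positivity)]
    rw [div_lt_iff₀ hxp] at hj
    linarith [mul_comm (x - L) ((2 : ℝ) ^ j)]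
  linarith

/-- **(E2, core) CONTINUOUS DEPENDENCE ON THE VISCOSITY, weighted sup norm.**  Admissible weights (`WeightRatiosLE ε₀ w A`), structure constants
bounded by `M_α`, `ν' ≥ 0`.  If `X` solves the `ν`-viscous and `Y` the `ν'`-viscous lattice within `[0,s]`, `s ≤ S`, from the same state at time
`0`, both obey `w_k|·(t)| ≤ B` on `[0,s]`, and `w_k λ^{2k}|X_{i,k}(t)| ≤ F` on `[0,s]`, then
`w_k|Y_{i,k}(t) − X_{i,k}(t)| ≤ 2^{⌈S(16 m² M_α A B + 1)⌉₊ + 1} F |ν' − ν|` on `[0,s]`.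
[cite: Teschl2012, Thm. 2.8 (Grönwall dependence on parameters); Tao2016AveragedNS, §4 Lemma 4.1 (4.5)] -/
theorem weighted_sub_le_of_viscosities {ε₀ ν ν' A Mα B F s S : ℝ} {α : Fin m → Fin m → Fin m → ℤ × ℤ × ℤ → ℝ}
    {w : ℤ → ℝ} (hε : 0 ≤ 1 + ε₀) (hw : WeightRatiosLE ε₀ w A) (hMα : 0 ≤ Mα)
    (hα : ∀ i₁ i₂ i₃ μ, |α i₁ i₂ i₃ μ| ≤ Mα) (hν' : 0 ≤ ν') (hB : 0 ≤ B) (hF : 0 ≤ F) (hsS : s ≤ S)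
    {X Y : Fin m → ℤ → ℝ → ℝ} (h0 : ∀ i k, X i k 0 = Y i k 0)
    (hXb : ∀ t ∈ Icc 0 s, ∀ i k, w k * |X i k t| ≤ B) (hYb : ∀ t ∈ Icc 0 s, ∀ i k, w k * |Y i k t| ≤ B)
    (hXF : ∀ t ∈ Icc 0 s, ∀ i k, w k * ((1 + ε₀) ^ ((2 : ℝ) * k) * |X i k t|) ≤ F)
    (hXd : ∀ i k, ∀ t ∈ Icc 0 s, HasDerivWithinAt (X i k)
      (quadTerm ε₀ α X i k t - ν * (1 + ε₀) ^ ((2 : ℝ) * k) * X i k t) (Icc 0 s) t)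
    (hYd : ∀ i k, ∀ t ∈ Icc 0 s, HasDerivWithinAt (Y i k)
      (quadTerm ε₀ α Y i k t - ν' * (1 + ε₀) ^ ((2 : ℝ) * k) * Y i k t) (Icc 0 s) t) :
    ∀ t ∈ Icc 0 s, ∀ i k, w k * |Y i k t - X i k t| ≤
      2 ^ (⌈S * (16 * (m : ℝ) ^ 2 * Mα * A * B + 1)⌉₊ + 1) * F * |ν' - ν| := by
  -- adapted from the proof of `viscousFlow_unique` (Literature/…/ViscousLatticeUniqueness.lean), with the viscous forcing added
  obtain ⟨hwpos, hrat⟩ := id hw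
  intro t₀ ht₀ i₀ k₀
  have hA : 0 ≤ A := le_trans (div_nonneg (Real.rpow_nonneg hε _) (hwpos 0).le) (hrat 0).1
  -- weighted slices on the window
  have hslice : ∀ (Z : Fin m → ℤ → ℝ → ℝ), (∀ t ∈ Icc 0 s, ∀ i k, w k * |Z i k t| ≤ B) →
      ∀ t ∈ Icc 0 s, ∃ T : Fin m × ℤ →ᵇ ℝ, ‖T‖ ≤ B ∧ ∀ i k, T (i, k) = w k * Z i k t := by
    intro Z hZ t ht
    have hH : ∀ p : Fin m × ℤ, ‖w p.2 * Z p.1 p.2 t‖ ≤ B := fun p => by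
      rw [Real.norm_eq_abs, abs_mul, abs_of_pos (hwpos p.2)]; exact hZ t ht p.1 p.2
    exact ⟨ofNormedAddCommGroupDiscrete (fun p : Fin m × ℤ => w p.2 * Z p.1 p.2 t) B hH,
      (norm_le hB).2 hH, fun i k => rfl⟩
  set K : ℝ := 8 * (m : ℝ) ^ 2 * Mα * A * B with hK
  have hK0 : 0 ≤ K := by positivity
  -- the Lipschitz estimate of the weighted nonlinearity along the two flows
  have hlipq : ∀ t ∈ Icc 0 s, ∀ (M : ℝ), (∀ i k, |w k * (Y i k t - X i k t)| ≤ M) → ∀ i k,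
      |w k * (quadTerm ε₀ α Y i k t - quadTerm ε₀ α X i k t)| ≤ K * M := by
    intro t ht M hM i k
    obtain ⟨TX, hTXb, hTX⟩ := hslice X hXb t ht
    obtain ⟨TY, hTYb, hTY⟩ := hslice Y hYb t ht
    have hqX : weightedFieldFun ε₀ α w TX (i, k) = w k * quadTerm ε₀ α X i k t := by
      simp only [weightedFieldFun, quadTerm, hTX, mul_div_cancel_left₀ _ (hwpos _).ne']
    have hqY : weightedFieldFun ε₀ α w TY (i, k) = w k * quadTerm ε₀ α Y i k t := by
      simp only [weightedFieldFun, quadTerm, hTY, mul_div_cancel_left₀ _ (hwpos _).ne']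
    have hM0 : 0 ≤ M := (abs_nonneg _).trans (hM i k)
    have hdist : ‖TY - TX‖ ≤ M := (norm_le hM0).2 fun p => by
      obtain ⟨j, n⟩ := p
      rw [BoundedContinuousFunction.coe_sub, Pi.sub_apply, hTX, hTY, Real.norm_eq_abs, ← mul_sub]
      exact hM j n
    have h := abs_weightedFieldFun_sub_le hε hw hMα hα hB hTYb hTXb i k
    rw [hqX, hqY, ← mul_sub] at h
    exact h.trans (by rw [hK]; exact mul_le_mul_of_nonneg_left hdist (by positivity))
  -- the forcing and the step length
  set Φ : ℝ := F * |ν' - ν| with hΦ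
  have hΦ0 : 0 ≤ Φ := by positivity
  set τ : ℝ := 1 / (2 * K + 1) with hτ
  have hτ0 : 0 < τ := by rw [hτ]; positivity
  have hτ1 : τ ≤ 1 := by rw [hτ, div_le_one (by positivity)]; linarith
  have hKτ : K * τ ≤ 1 / 2 := by
    rw [hτ, mul_one_div, div_le_iff₀ (by positivity)]; linarith
  -- induction over windows of length `τ`
  have main : ∀ n : ℕ, ∀ t ∈ Icc 0 s, t ≤ n * τ → ∀ i k,
      |w k * (Y i k t - X i k t)| ≤ (2 ^ n - 1) * (2 * Φ * τ) := by
    intro n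
    induction n with
    | zero =>
      intro t ht htn i k
      have : t = 0 := le_antisymm (by simpa using htn) ht.1
      rw [this, h0, sub_self, mul_zero, abs_zero]
      simp
    | succ n ih =>
      intro t ht htn i k
      have hmono : ((2 : ℝ) ^ n - 1) * (2 * Φ * τ) ≤ (2 ^ (n + 1) - 1) * (2 * Φ * τ) := by
        refine mul_le_mul_of_nonneg_right ?_ (by positivity)
        rw [pow_succ]; linarith [one_le_pow₀ (by norm_num : (1 : ℝ) ≤ 2) (n := n)]
      rcases le_or_gt t (n * τ) with hle | hle
      · exact (ih t ht hle i k).trans hmono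
      set a : ℝ := n * τ with ha
      have ha0 : 0 ≤ a := by positivity
      have has : a ∈ Icc 0 s := ⟨ha0, hle.le.trans ht.2⟩
      have hta : t - a ≤ τ := by rw [ha]; push_cast at htn; linarith
      set U : ℝ := (2 ^ n - 1) * (2 * Φ * τ) with hU
      have hU0 : 0 ≤ U := by
        rw [hU]
        exact mul_nonneg (by linarith [one_le_pow₀ (by norm_num : (1 : ℝ) ≤ 2) (n := n)]) (by positivity)
      set L : ℝ := 2 * U + 2 * Φ * τ with hL
      have hL0 : 0 ≤ L := by rw [hL]; positivity
      -- geometric bootstrap of the difference bound on `[a, t]`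
      have hgeo : ∀ j : ℕ, ∀ r ∈ Icc a t, ∀ i k, |w k * (Y i k r - X i k r)| ≤ L + 2 * B / 2 ^ j := by
        intro j
        induction j with
        | zero =>
          intro r hr i k
          have hrs : r ∈ Icc 0 s := ⟨ha0.trans hr.1, hr.2.trans ht.2⟩
          rw [pow_zero, div_one, mul_sub, two_mul]
          refine (abs_sub _ _).trans ?_
          rw [abs_mul, abs_of_pos (hwpos k), abs_mul, abs_of_pos (hwpos k)]
          linarith [hXb r hrs i k, hYb r hrs i k]
        | succ j ihj =>
          intro r hr i k
          have hsub : Icc a t ⊆ Icc 0 s := fun u hu => ⟨ha0.trans hu.1, hu.2.trans ht.2⟩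
          -- the weighted difference solves `g' = q − κ g` on `[a, t]`
          have hg : ∀ u ∈ Icc a t, HasDerivWithinAt (fun u => w k * (Y i k u - X i k u))
              ((w k * (quadTerm ε₀ α Y i k u - quadTerm ε₀ α X i k u) -
                  (ν' - ν) * (1 + ε₀) ^ ((2 : ℝ) * k) * (w k * X i k u)) -
                ν' * (1 + ε₀) ^ ((2 : ℝ) * k) * (w k * (Y i k u - X i k u))) (Icc a t) u := by
            intro u hu
            have h1 := ((hYd i k u (hsub hu)).sub (hXd i k u (hsub hu))).const_mul (w k)
            exact (h1.mono hsub).congr_deriv (by ring)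
          have hqb : ∀ u ∈ Icc a t, |w k * (quadTerm ε₀ α Y i k u - quadTerm ε₀ α X i k u) -
              (ν' - ν) * (1 + ε₀) ^ ((2 : ℝ) * k) * (w k * X i k u)| ≤ K * (L + 2 * B / 2 ^ j) + Φ := by
            intro u hu
            refine (abs_sub _ _).trans (add_le_add (hlipq u (hsub hu) _ (ihj u hu) i k) ?_)
            rw [abs_mul, abs_mul, abs_mul, abs_of_pos (hwpos k), abs_of_nonneg (Real.rpow_nonneg hε _), hΦ]
            have := hXF u (hsub hu) i k
            nlinarith [abs_nonneg (ν' - ν)]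
          have h := abs_le_of_forcing_on_Icc (mul_nonneg hν' (Real.rpow_nonneg hε _)) hg hqb r hr
          have hga : |w k * (Y i k a - X i k a)| ≤ U := ih a has le_rfl i k
          refine h.trans ?_
          have hra : r - a ≤ τ := by linarith [hr.2]
          have hra0 : 0 ≤ r - a := by linarith [hr.1]
          have hQ0 : 0 ≤ K * (L + 2 * B / 2 ^ j) + Φ := by positivity
          have h2B : 0 ≤ 2 * B / 2 ^ j := by positivity
          calc |w k * (Y i k a - X i k a)| + (K * (L + 2 * B / 2 ^ j) + Φ) * (r - a)
              ≤ U + (K * (L + 2 * B / 2 ^ j) + Φ) * τ := add_le_add hga (mul_le_mul_of_nonneg_left hra hQ0)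
            _ = U + (K * τ) * L + (K * τ) * (2 * B / 2 ^ j) + Φ * τ := by ring
            _ ≤ U + (1 / 2) * L + (1 / 2) * (2 * B / 2 ^ j) + Φ * τ := by
                have e1 := mul_le_mul_of_nonneg_right hKτ hL0
                have e2 := mul_le_mul_of_nonneg_right hKτ h2B
                linarith
            _ = L + 2 * B / 2 ^ (j + 1) := by rw [hL, pow_succ]; ring
      have hfin := le_of_forall_le_add_div_two_pow (fun j => hgeo j t ⟨hle.le, le_rfl⟩ i k)
      refine hfin.trans (le_of_eq ?_)
      rw [hL, hU, pow_succ]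
      ring
  -- the number of windows
  set N : ℕ := ⌈S * (2 * K + 1)⌉₊ with hN
  have hsN : s ≤ N * τ := by
    have h1 : S * (2 * K + 1) ≤ N := Nat.le_ceil _
    have h2 : s * (2 * K + 1) ≤ S * (2 * K + 1) := mul_le_mul_of_nonneg_right hsS (by positivity)
    rw [hτ, mul_one_div, le_div_iff₀ (by positivity)]
    linarith
  have hmain := main N t₀ ht₀ (ht₀.2.trans hsN) i₀ k₀
  rw [abs_mul, abs_of_pos (hwpos k₀)] at hmain
  refine hmain.trans ?_
  have hK' : 16 * (m : ℝ) ^ 2 * Mα * A * B + 1 = 2 * K + 1 := by rw [hK]; ring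
  rw [hK', ← hN]
  have h2N : (1 : ℝ) ≤ 2 ^ N := one_le_pow₀ (by norm_num)
  calc ((2 : ℝ) ^ N - 1) * (2 * Φ * τ) ≤ 2 ^ N * (2 * Φ * τ) :=
        mul_le_mul_of_nonneg_right (by linarith) (by positivity)
    _ = 2 ^ (N + 1) * Φ * τ := by rw [pow_succ]; ring
    _ ≤ 2 ^ (N + 1) * Φ * 1 := mul_le_mul_of_nonneg_left hτ1 (by positivity)
    _ = 2 ^ (N + 1) * F * |ν' - ν| := by rw [hΦ]; ring

end Summit.NavierStokesRegularity.NavierStokesRegularity.Theorems.MinimalViscousBlowup.ThresholdRay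

end
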